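import Summits.KontsevichZagierPeriods.KontsevichZagierPeriods.Theorems.RootDecompWalshStrataWalshSpanCells
import Summits.KontsevichZagierPeriods.KontsevichZagierPeriods.Theses.RootDecompWalshStrata

/-!
# `WalshSpan` (item stmt-KontsevichZagierPeriods-25395, route RootDecompWalshStrata) — PROOF, part 3/3

Part 3/3 of the proof of item stmt-KontsevichZagierPeriods-25395 `RootDecompWalshStrata.WalshSpan`
(route RootDecompWalshStrata; decomposition cell decomp-kz, lens 4, gen 2 — port of `section Edges`/Edge W
of `run/shared/lean/pub/decomp-kz/decomp-kz-lens-4/WalshStrata.lean` v2, kernel-checked there).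
Files: `…WalshSpanWeighted` (the Walsh span `walshSpanned`, weighted scissors) → `…WalshSpanCells`
(cube normal form, sign cells, Walsh sums) → `…WalshSpan` (the expansion and `walshSpan_proof`, which
proves the route decl BY NAME). Reused landed/Literature results BY NAME: `LogPolytope.stub_scissors`,
`KZ.ratCast_smul_sub_mem_relations` [KZDilationMove], `KZ.scale`,
`IsSemialgebraic.exists_finset_signDetermined` [SemialgebraicSigns], `KZ.exists_translate`,
`KZ.exists_sub_isBounded`, `volume_setOf_aeval_eq_zero`.

This file: `spanned_of_cubeRep` — a cube representation `[D, w]`, `D ⊆ (0,1)^N` sign-determined by a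
finite family `F` of non-zero polynomials, is Walsh-spanned: off the null zero sets
(`volume_setOf_aeval_eq_zero`), `1_D = Σ_{η good} 1_{C_η}` and `2^m 1_{C_η} = Σ_T (2·1[g_{η,T}>0] − 1)`,
so `[D,w] − Σ_{η,T} [cell(g_{η,T}), 2w/2^m] + |good| · [cube, w]` is a weighted scissors relation;
then `spanned_of` (every `[r]`, via `KZ.exists_sub_isBounded` [ViuSos2021 §4]) and `walshSpan_proof`
(merge two families into one) — the route decl `RootDecompWalshStrata.WalshSpan` BY NAME.
Checked in the cell: rc 0 / 0 sorry / axioms propext · Classical.choice · Quot.sound.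
[KontsevichZagier2001 §1.2 rules (1)–(2); BCR1998 §2.1; ViuSos2021 §4; folklore]
-/

noncomputable section

open Literature.NumberTheory.Transcendental
open Literature.ModelTheory.ExponentialFields
open MeasureTheory Set
open MvPolynomial (aeval X C)

namespace Summit.KontsevichZagierPeriods.RootDecompWalshStrata.WalshSpanProof

/-- **A cube representation with constant rational weight is Walsh-spanned** (sign determination,
Walsh expansion, weighted scissors). -/
theorem spanned_of_cubeRep {N : ℕ} (r : KZ.IntegralRep N) (w : ℚ)
    (hcube : ∀ x ∈ r.domain, ∀ j, 0 < x j ∧ x j < 1)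
    (hw : ∀ x ∈ r.domain, r.integrand x = (w : ℝ)) : KZ.of r ∈ walshSpanned := by
  classical
  obtain ⟨F₀, (hF₀ : ∀ x y : Fin N → ℝ,
      (∀ p ∈ F₀, SignType.sign (aeval x p) = SignType.sign (aeval y p)) → (x ∈ r.domain ↔ y ∈ r.domain))⟩ :=
    r.isSemialgebraic_domain.exists_finset_signDetermined
  set F : Finset (MvPolynomial (Fin N) ℚ) := F₀.filter (· ≠ 0) with hF_def
  have hFne : ∀ p : F, (p : MvPolynomial (Fin N) ℚ) ≠ 0 := fun p => (Finset.mem_filter.mp p.2).2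
  have hF : ∀ x y : Fin N → ℝ, (∀ p ∈ F, SignType.sign (aeval x p) = SignType.sign (aeval y p)) →
      (x ∈ r.domain ↔ y ∈ r.domain) := by
    intro x y hxy
    refine hF₀ x y fun p hp => ?_
    by_cases hp0 : p = 0
    · simp [hp0]
    · exact hxy p (Finset.mem_filter.mpr ⟨hp, hp0⟩)
  set D : Set (Fin N → ℝ) := r.domain with hD_def
  set m : ℕ := Fintype.card F with hm_def
  set Gd : Finset (F → Bool) := Finset.univ.filter (fun η => cellSet F η ⊆ D) with hGd_def
  have hGd : ∀ η, η ∈ Gd ↔ cellSet F η ⊆ D := fun η => by simp [hGd_def]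
  -- the Walsh family: the cells `(η, T)`, `η` good, `T ⊆ F`, and the cube itself
  set wc : ℚ := w * 2 / 2 ^ m with hwc_def
  let ρc : Gd × Finset F → KZ.IntegralRep N := fun i => cellRep (gPoly F i.1.1 i.2) wc
  let ρ0 : KZ.IntegralRep N := cellRep (1 : MvPolynomial (Fin N) ℚ) w
  let ρρ : (Gd × Finset F) ⊕ Unit → KZ.IntegralRep N := Sum.elim ρc fun _ => ρ0
  let cc : (Gd × Finset F) ⊕ Unit → ℤ := Sum.elim (fun _ => 1) fun _ => -(Gd.card : ℤ)
  let qq : (Gd × Finset F) ⊕ Unit → ℚ := Sum.elim (fun _ => wc) fun _ => w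
  -- the scissors family `r, cells, cube`
  let ρI : Option ((Gd × Finset F) ⊕ Unit) → KZ.IntegralRep N := fun o =>
    match o with
    | none => r
    | some j => ρρ j
  let εI : Option ((Gd × Finset F) ⊕ Unit) → ℤ := fun o =>
    match o with
    | none => 1
    | some j => -cc j
  let qI : Option ((Gd × Finset F) ⊕ Unit) → ℚ := fun o =>
    match o with
    | none => w
    | some j => qq j
  have hnull : volume (⋃ p : F, {x : Fin N → ℝ | aeval x (p : MvPolynomial (Fin N) ℚ) = 0}) = 0 := by
    refine measure_iUnion_null_iff.mpr fun p => volume_setOf_aeval_eq_zero _ ?_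
    simpa using (MvPolynomial.map_injective (algebraMap ℚ ℝ) (algebraMap ℚ ℝ).injective).ne (hFne p)
  -- the pointwise Walsh identity off the zero sets
  have hpt : ∀ x : Fin N → ℝ, (∀ p : F, aeval x (p : MvPolynomial (Fin N) ℚ) ≠ 0) →
      ∑ o, (εI o : ℝ) * (qI o : ℝ) * (ρI o).domain.indicator (fun _ => (1 : ℝ)) x = 0 := by
    intro x hx0
    have e : ∑ o, (εI o : ℝ) * (qI o : ℝ) * (ρI o).domain.indicator (fun _ => (1 : ℝ)) x =
        ((1 : ℤ) : ℝ) * (w : ℝ) * D.indicator (fun _ => (1 : ℝ)) x +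
          (∑ i : Gd × Finset F,
              ((-1 : ℤ) : ℝ) * (wc : ℝ) * (ρc i).domain.indicator (fun _ => (1 : ℝ)) x +
            ((-(-(Gd.card : ℤ)) : ℤ) : ℝ) * (w : ℝ) * ρ0.domain.indicator (fun _ => (1 : ℝ)) x) := by
      rw [Fintype.sum_option, Fintype.sum_sum_type]
      simp only [Finset.univ_unique, Finset.sum_singleton]
      rfl
    rw [e]
    by_cases hxc : ∀ j, 0 < x j ∧ x j < 1
    · -- inside the cube
      have hinner : ∀ η : F → Bool,
          2 * ∑ T : Finset F, (if 0 < aeval x (gPoly F η T) then (1 : ℝ) else 0) =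
            2 ^ m * ((if x ∈ cellSet F η then (1 : ℝ) else 0) + 1) := fun η => by
        have h := walsh_sum_indicator
          (fun p : F => (sgnQ η p : ℝ) * aeval x (p : MvPolynomial (Fin N) ℚ))
          (fun p => mul_ne_zero (sgnQ_cast_ne_zero η p) (hx0 p))
        simp only [aeval_gPoly]
        rw [hm_def]
        by_cases hc : x ∈ cellSet F η
        · rw [if_pos hc]
          rw [if_pos (show ∀ p : F, 0 < (sgnQ η p : ℝ) *
            aeval x (p : MvPolynomial (Fin N) ℚ) from hc)] at h
          exact h
        · rw [if_neg hc]
          rw [if_neg (fun h' : ∀ p : F, 0 < (sgnQ η p : ℝ) *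
            aeval x (p : MvPolynomial (Fin N) ℚ) => hc h')] at h
          exact h
      have houter : ∑ η ∈ Gd, (if x ∈ cellSet F η then (1 : ℝ) else 0) = if x ∈ D then 1 else 0 :=
        sum_ite_mem_cellSet F hF Gd hGd hx0
      have e2 : ∀ η : Gd, ∑ T : Finset F,
          ((-1 : ℤ) : ℝ) * (wc : ℝ) * (ρc (η, T)).domain.indicator (fun _ => (1 : ℝ)) x =
            -(w : ℝ) * ((if x ∈ cellSet F η.1 then (1 : ℝ) else 0) + 1) := fun η => by
        have hχ : ∀ T : Finset F, (ρc (η, T)).domain.indicator (fun _ => (1 : ℝ)) x =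
            if 0 < aeval x (gPoly F η.1 T) then (1 : ℝ) else 0 := fun T => by
          rw [Set.indicator_apply]
          simp only [ρc, cellRep_domain, Set.mem_setOf_eq]
          by_cases hg : 0 < aeval x (gPoly F η.1 T)
          · rw [if_pos ⟨hxc, hg⟩, if_pos hg]
          · rw [if_neg (fun h => hg h.2), if_neg hg]
        simp_rw [hχ]
        rw [← Finset.mul_sum]
        have h2 := hinner η.1
        have h2m : (2 : ℝ) ^ m ≠ 0 := pow_ne_zero _ two_ne_zero
        have hS : ∑ T : Finset F, (if 0 < aeval x (gPoly F η.1 T) then (1 : ℝ) else 0) =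
            2 ^ m * ((if x ∈ cellSet F η.1 then (1 : ℝ) else 0) + 1) / 2 := by
          rw [← h2]; ring
        rw [hS, hwc_def]
        push_cast
        field_simp
      have e3 : ∑ i : Gd × Finset F,
          ((-1 : ℤ) : ℝ) * (wc : ℝ) * (ρc i).domain.indicator (fun _ => (1 : ℝ)) x =
            -(w : ℝ) * ((if x ∈ D then (1 : ℝ) else 0) + Gd.card) := by
        rw [Fintype.sum_prod_type]
        simp_rw [e2]
        have hsum1 : ∑ η : Gd, (if x ∈ cellSet F (η : F → Bool) then (1 : ℝ) else 0) =
            if x ∈ D then 1 else 0 := by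
          rw [Finset.sum_coe_sort Gd (fun η => if x ∈ cellSet F η then (1 : ℝ) else 0), houter]
        have hsum2 : ∑ η : Gd, (-(w : ℝ) * ((if x ∈ cellSet F (η : F → Bool) then (1 : ℝ) else 0) + 1))
            = -(w : ℝ) * (∑ η : Gd, (if x ∈ cellSet F (η : F → Bool) then (1 : ℝ) else 0) +
                ∑ _η : Gd, (1 : ℝ)) := by
          rw [← Finset.sum_add_distrib, Finset.mul_sum]
        rw [hsum2, hsum1, Finset.sum_const, Finset.card_univ, Fintype.card_coe, nsmul_eq_mul,
          mul_one]
      have hind0 : ρ0.domain.indicator (fun _ => (1 : ℝ)) x = 1 := by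
        rw [Set.indicator_of_mem]
        show (∀ j, 0 < x j ∧ x j < 1) ∧ 0 < aeval x (1 : MvPolynomial (Fin N) ℚ)
        exact ⟨hxc, by simp⟩
      rw [e3, hind0, Set.indicator_apply]
      push_cast
      split_ifs <;> ring
    · -- outside the cube every indicator vanishes
      have hD0 : D.indicator (fun _ => (1 : ℝ)) x = 0 :=
        Set.indicator_of_notMem (fun h => hxc (hcube x h)) _
      have hc0 : ∀ i : Gd × Finset F, (ρc i).domain.indicator (fun _ => (1 : ℝ)) x = 0 :=
        fun i => Set.indicator_of_notMem (fun h => hxc h.1) _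
      have h00 : ρ0.domain.indicator (fun _ => (1 : ℝ)) x = 0 :=
        Set.indicator_of_notMem (fun h => hxc h.1) _
      simp [hD0, hc0, h00]
  -- the scissors congruence
  have hsc : ∑ o, εI o • KZ.of (ρI o) ∈ KZ.relations := by
    refine weighted_scissors N ρI qI εI ?_ ?_ ?_
    · rintro (_ | j | _) x hx
      · exact hw x hx
      · rfl
      · rfl
    · rintro (_ | j | _)
      · exact (isBounded_cubeSet N).subset fun x hx => hcube x hx
      · exact (isBounded_cubeSet N).subset fun x hx => hx.1
      · exact (isBounded_cubeSet N).subset fun x hx => hx.1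
    · refine ae_iff.mpr (measure_mono_null (fun x hx => ?_) hnull)
      by_contra hxZ
      exact hx (hpt x fun p h0 => hxZ (Set.mem_iUnion.mpr ⟨p, h0⟩))
  have hsc' : (1 : ℤ) • KZ.of r + ∑ j, (-cc j) • KZ.of (ρρ j) ∈ KZ.relations := by
    rw [Fintype.sum_option] at hsc
    exact hsc
  refine ⟨(Gd × Finset F) ⊕ Unit, inferInstance, fun _ => N,
    Sum.elim (fun i => gPoly F i.1.1 i.2) (fun _ => (1 : MvPolynomial (Fin N) ℚ)), qq, ρρ, cc, ?_, ?_⟩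
  · rintro (i | _)
    · exact ⟨rfl, fun x _ => rfl⟩
    · exact ⟨rfl, fun x _ => rfl⟩
  · have : KZ.of r - ∑ j, cc j • KZ.of (ρρ j) = (1 : ℤ) • KZ.of r + ∑ j, (-cc j) • KZ.of (ρρ j) := by
      simp only [one_smul, neg_smul, Finset.sum_neg_distrib, sub_eq_add_neg]
    rw [this]
    exact hsc'

/-- A bounded integrand-`1` representation is Walsh-spanned. -/
theorem spanned_of_bounded_one {N : ℕ} (A : KZ.IntegralRep N) (hbd : Bornology.IsBounded A.domain)
    (h1 : ∀ x ∈ A.domain, A.integrand x = 1) : KZ.of A ∈ walshSpanned := by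
  obtain ⟨r, w, hcube, hw, hrel⟩ := exists_cubeRep A hbd h1
  exact walshSpanned_congr (spanned_of_cubeRep r w hcube hw) hrel

/-- Every representation is Walsh-spanned (`[r] ≡ [A] − [B]`, bounded volumes one dimension up). -/
theorem spanned_of {n : ℕ} (r : KZ.IntegralRep n) : KZ.of r ∈ walshSpanned := by
  obtain ⟨A, B, hA, hB, hA1, hB1, hrel⟩ := KZ.exists_sub_isBounded r
  exact walshSpanned_congr
    (walshSpanned_sub (spanned_of_bounded_one A hA hA1) (spanned_of_bounded_one B hB hB1)) hrel

/-- **`WalshSpan` (item stmt-KontsevichZagierPeriods-25395) holds** — the route decl BY NAME: any two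
representations lie in the span of ONE Walsh family (merge the two families of `spanned_of`).
[KontsevichZagier2001 §1.2 rules (1)–(2); BCR1998 §2.1; ViuSos2021 §4; folklore (Walsh expansion)] -/
theorem walshSpan_proof :
    Summit.KontsevichZagierPeriods.KontsevichZagierPeriods.Theses.RootDecompWalshStrata.WalshSpan := by
  intro n m r r' _ _
  obtain ⟨ι₁, _, d₁, P₁, q₁, ρ₁, c₁, hW₁, h₁⟩ := spanned_of r
  obtain ⟨ι₂, _, d₂, P₂, q₂, ρ₂, c₂, hW₂, h₂⟩ := spanned_of r'
  classical
  let d : ι₁ ⊕ ι₂ → ℕ := Sum.elim d₁ d₂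
  let P : (i : ι₁ ⊕ ι₂) → MvPolynomial (Fin (d i)) ℚ := fun i =>
    match i with
    | .inl i => P₁ i
    | .inr i => P₂ i
  let ρ : (i : ι₁ ⊕ ι₂) → KZ.IntegralRep (d i) := fun i =>
    match i with
    | .inl i => ρ₁ i
    | .inr i => ρ₂ i
  let q : ι₁ ⊕ ι₂ → ℚ := Sum.elim q₁ q₂
  let c : ι₁ ⊕ ι₂ → ℤ := Sum.elim c₁ fun _ => 0
  let c' : ι₁ ⊕ ι₂ → ℤ := Sum.elim (fun _ => 0) c₂
  have hW : ∀ i, (ρ i).domain = {x | (∀ j, 0 < x j ∧ x j < 1) ∧ 0 < MvPolynomial.aeval x (P i)} ∧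
      ∀ x ∈ (ρ i).domain, (ρ i).integrand x = (q i : ℝ) := by
    rintro (i | i)
    · exact hW₁ i
    · exact hW₂ i
  have ec : ∑ i, c i • KZ.of (ρ i) = ∑ i, c₁ i • KZ.of (ρ₁ i) + ∑ i : ι₂, (0 : ℤ) • KZ.of (ρ₂ i) :=
    Fintype.sum_sum_type _
  have ec' : ∑ i, c' i • KZ.of (ρ i) =
      ∑ i : ι₁, (0 : ℤ) • KZ.of (ρ₁ i) + ∑ i, c₂ i • KZ.of (ρ₂ i) :=
    Fintype.sum_sum_type _
  simp only [zero_smul, Finset.sum_const_zero, add_zero, zero_add] at ec ec'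
  let e := Fintype.equivFin (ι₁ ⊕ ι₂)
  refine ⟨Fintype.card (ι₁ ⊕ ι₂), fun i => d (e.symm i), fun i => P (e.symm i),
    fun i => q (e.symm i), fun i => ρ (e.symm i), fun i => c (e.symm i), fun i => c' (e.symm i),
    fun i => hW (e.symm i), ?_, ?_⟩
  · have : ∑ i, c (e.symm i) • KZ.of (ρ (e.symm i)) = ∑ i, c i • KZ.of (ρ i) :=
      Fintype.sum_equiv e.symm _ _ fun _ => rfl
    rw [this, ec]
    exact h₁
  · have : ∑ i, c' (e.symm i) • KZ.of (ρ (e.symm i)) = ∑ i, c' i • KZ.of (ρ i) :=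
      Fintype.sum_equiv e.symm _ _ fun _ => rfl
    rw [this, ec']
    exact h₂

end Summit.KontsevichZagierPeriods.RootDecompWalshStrata.WalshSpanProof
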